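import Literature.Probability.RandomPlanarGeometry.SLEImageBM
import Summits.CriticalPhenomena.SAWScalingLimit.Theorems.SAWRenewalTightnessSubseqIdentificationThm65TiltedTilting
import HarnessLib

/-!
# The tilted [LSW] Theorem 6.5 (line `boundary-area-law`, RS5b): the image Brownian motion under the tilted probability

Line `boundary-area-law` of the crux `SubseqIdentification` (stmt-CriticalPhenomena-0783), restriction
reshape (lead c4, r-c4-3), stub RS5b `stub_thm65Tilted` (the Girsanov reading of G. F. Lawler,
O. Schramm, W. Werner, *Conformal restriction: the chordal case*, J. Amer. Math. Soc. 16 (2003),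
Prop. 5.3 with §5 (5.1)–(5.3): under the tilted probability `Q̄_A = (Y_∞ / Φ_A′(0)^α) · P` the image
driving function `W̃ = h_t(W_t)`, run by the capacity clock `∫ h_s′(W_s)² ds`, is `√κ ×` a Brownian
motion). Milestone (T4) of the plan `RS5b-PLAN.md`: **the Dambis–Dubins–Schwarz step under an
arbitrary probability measure on the Wiener space.**

* `exists_sle_image_brownian_of_clock` — for every `κ > 0`, nonempty `A ∈ 𝒬*`, level `n` and every
  probability measure `Q` on the canonical space under which the localised image driving function
  `Mⁿ/√κ = imgMartK κ hA hne n / √κ` carries the martingale clock `imgClockK κ hA hne n`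
  (`Process.HasMartingaleClock`), there is on `(Ω × Ω, Q ⊗ P_W)` a real Brownian motion `Bc` with
  continuous paths and measurable marginals such that, for every sample whose localising time
  `T₀ = imgLocTimeK κ hA hne n` is positive, `√κ · Bc s = Loewner.imageDriverC W A T₀ s` (the image
  driving function in capacity time) for all capacity times `s ≤ σ(T₀) = Loewner.imageClock W A T₀`.
  This is the tree's `exists_sle_image_brownian` (`κ = 6`, `Q = P_W`, where the clock comes from the
  locality computation `hasMartingaleClock_imgMartK`) with the measure and `κ` made parameters: the
  proof is the same DDS time change (`HasMartingaleClock.timeChange`) and concatenation with an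
  independent Brownian motion (`isBrownianReal_concat`), both valid for any probability measure;
* `exists_sle_image_brownian_tilted` — the instance for the normalised tilted probability of
  `hasMartingaleClock_imgMartK_tilted` ((T3), landed): given the two `P`-martingale identities (T2)
  for `Mⁿ · Y` and `((Mⁿ)² − κ cⁿ) · Y`, the image Brownian motion exists under `Q̄_A ⊗ P_W`.

References: [LSW] §5; Lawler–Schramm–Werner, Acta Math. 187 (2001) Thm. 2.2 (the case `κ = 6`);
Revuz–Yor (1999) Ch. V Thm. (1.6)–(1.7). No named fact is used.
-/

noncomputable section

open Set Filter Metric Function MeasureTheory ProbabilityTheory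
open scoped NNReal ENNReal Topology
open Literature.Probability.RandomPlanarGeometry
open Literature.Probability.Process
open UpperHalfPlane (upperHalfPlaneSet)

namespace Summit.CriticalPhenomena.SAWScalingLimit.Theorems.SubseqIdentification.BoundaryAreaLaw

open Loewner PathOps

variable {κ : ℝ≥0} {A : Set ℂ}

/-- **The image Brownian motion at level `n` under an arbitrary probability measure** (DDS time change
of `Mⁿ/√κ` by its clock, concatenated with an independent Brownian motion, read back in capacity time).
For `κ > 0`, a nonempty `*`-hull `A`, `n ∈ ℕ` and a probability measure `Q` on the canonical space under
which `imgMartK κ hA hne n / √κ` carries the martingale clock `imgClockK κ hA hne n` with bound `N`,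
there is a real Brownian motion `Bc` on `(Ω × Ω, Q ⊗ P_W)` with continuous paths and measurable
marginals such that `√κ · Bc s z = Loewner.imageDriverC W A T₀ s` for all `s ≤ Loewner.imageClock W A T₀`
whenever `T₀ = imgLocTimeK κ hA hne n z.1 > 0` (`W = drvK κ (brownianCPath z.1)`).
[cite: LawlerSchrammWerner2001, Thm. 2.2 (proof, DDS step)] -/
theorem exists_sle_image_brownian_of_clock (hκ0 : 0 < κ) (hA : IsStarHull A) (hne : A.Nonempty) (n : ℕ)
    {Q : Measure (ℝ≥0 → ℝ)} [IsProbabilityMeasure Q] {N : ℝ}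
    (hclock : HasMartingaleClock (fun t ω ↦ (Real.sqrt κ)⁻¹ * imgMartK κ hA hne n t ω) (imgClockK κ hA hne n)
      brownianFiltration Q N) :
    ∃ Bc : ℝ≥0 → (ℝ≥0 → ℝ) × (ℝ≥0 → ℝ) → ℝ,
      IsBrownianReal Bc (Q.prod preWienerMeasure) ∧
      (∀ s, Measurable (Bc s)) ∧ (∀ z, Continuous (Bc · z)) ∧
      ∀ (z : (ℝ≥0 → ℝ) × (ℝ≥0 → ℝ)) (T₀ : ℝ≥0), imgLocTimeK κ hA hne n z.1 = T₀ → 0 < T₀ →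
        ∀ s : ℝ≥0, (s : ℝ) ≤ imageClock (drvK κ (brownianCPath z.1)) A T₀ →
          Real.sqrt κ * Bc s z = imageDriverC (drvK κ (brownianCPath z.1)) A T₀ s := by
  have hsκ : (0 : ℝ) < Real.sqrt κ := Real.sqrt_pos.2 (by exact_mod_cast hκ0)
  set τ := imgLocTimeK κ hA hne n with hτdef
  set Tn : ℝ≥0 := (n : ℝ≥0) + 1 with hTn
  set ρ : (ℝ≥0 → ℝ) → ℝ≥0 := fun ω ↦ (min (Tn : WithTop ℝ≥0) (τ ω)).untopA with hρdef
  have hρcoe : ∀ ω, (ρ ω : WithTop ℝ≥0) = τ ω := fun ω ↦ coe_untopA_min_imgLocTimeK (κ := κ) (hA := hA) (hne := hne) n ω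
  set Y : ℝ≥0 → (ℝ≥0 → ℝ) → ℝ := fun t ω ↦ (Real.sqrt κ)⁻¹ * imgMartK κ hA hne n t ω with hYdef
  set c : ℝ≥0 → (ℝ≥0 → ℝ) → ℝ := imgClockK κ hA hne n with hcdef
  set 𝓕 : Filtration ℝ≥0 (inferInstance : MeasurableSpace (ℝ≥0 → ℝ)) := brownianFiltration with h𝓕
  -- Step 1: the martingale clock and the time change
  have hYad : StronglyAdapted 𝓕 Y := fun t ↦ ((stronglyAdapted_imgMartK (κ := κ) (hA := hA) (hne := hne) n) t).const_mul _
  have hYc : ∀ ω, Continuous (Y · ω) := fun ω ↦ continuous_const.mul (continuous_imgMartK n ω)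
  have hcad : Adapted 𝓕 c := adapted_imgClockK n
  have hρst : IsStoppingTime 𝓕 fun ω ↦ (ρ ω : WithTop ℝ≥0) := by
    have heq : (fun ω ↦ (ρ ω : WithTop ℝ≥0)) = τ := funext hρcoe
    rw [heq]; exact isStoppingTime_imgLocTimeK n
  have hρT : ∀ ω, ρ ω ≤ Tn := fun ω ↦ Literature.Analysis.FunctionSpaces.untopA_min_le _ _
  have hfrozen : ∀ t ω, c t ω = c (min t (ρ ω)) ω := by
    intro t ω
    rw [hcdef, imgClockK_eq_timeIntegral_min, imgClockK_eq_timeIntegral_min]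
    congr 1
    rw [← hτdef, WithTop.coe_min, hρcoe, min_assoc, min_self]
  have htc := hclock.timeChange hYad hYc hcad hρst hρT hfrozen
  have hcc := hclock.continuous_clock
  have hc0 := hclock.clock_zero
  have hmono := hclock.monotone_clock
  have hnn : ∀ t ω, 0 ≤ c t ω := fun t ω ↦ hclock.clock_nonneg ω t
  have hstrict : ∀ ω, StrictMonoOn (fun t ↦ c t ω) (Icc 0 (ρ ω)) := fun ω ↦
    strictMonoOn_imgClockK (κ := κ) (hA := hA) (hne := hne) (n := n) (by rw [hρcoe])
  set 𝒢 := tcFiltration hcad hcc hρst with h𝒢def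
  -- Step 2: concatenation with an independent Brownian motion
  set σc : (ℝ≥0 → ℝ) → ℝ≥0 := fun ω ↦ (totalClock c ρ ω).toNNReal with hσcdef
  have hσc0 : ∀ ω, 0 ≤ totalClock c ρ ω := fun ω ↦ hclock.clock_nonneg ω _
  have hσccoe : ∀ ω, ((σc ω : ℝ≥0) : ℝ) = totalClock c ρ ω := fun ω ↦ Real.coe_toNNReal _ (hσc0 ω)
  have hmin_eq : ∀ (s : ℝ≥0) ω, min (s : ℝ) (totalClock c ρ ω) = ((min s (σc ω) : ℝ≥0) : ℝ) := by
    intro s ω; rw [NNReal.coe_min, hσccoe]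
  have htc' : HasMartingaleClock (tcProc Y c ρ) (fun s ω ↦ ((min s (σc ω) : ℝ≥0) : ℝ)) 𝒢 Q N := by
    have heq : (fun (s : ℝ≥0) ω ↦ ((min s (σc ω) : ℝ≥0) : ℝ)) = fun (s : ℝ≥0) ω ↦ min (s : ℝ) (totalClock c ρ ω) := by
      funext s ω; exact (hmin_eq s ω).symm
    rw [heq]; exact htc
  have hYprog : IsStronglyProgressive 𝓕 Y := hYad.isStronglyProgressive_of_continuous hYc
  have hcontY : ∀ ω, Continuous fun s ↦ tcProc Y c ρ s ω := continuous_tcProc hYc hc0 hcc hmono hstrict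
  have hYad' : ∀ s, StronglyMeasurable[𝒢 s] (tcProc Y c ρ s) := fun s ↦
    (measurable_tcProc hcad hcc hρst hYprog s).stronglyMeasurable
  have hσcm : Measurable σc := (measurable_totalClock hcad hcc hρst).real_toNNReal
  have hcad' : ∀ s : ℝ≥0, Measurable[𝒢 s] fun ω ↦ min s (σc ω) := by
    intro s
    have h1 := (measurable_min_totalClock hcad hcc hρst hc0 hmono hfrozen s).real_toNNReal
    have heq : (fun ω ↦ (min (s : ℝ) (totalClock c ρ ω)).toNNReal) = fun ω ↦ min s (σc ω) := by
      funext ω; rw [hmin_eq, Real.toNNReal_coe]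
    rwa [heq] at h1
  have hY0 : ∀ ω, tcProc Y c ρ 0 ω = 0 := fun ω ↦ by
    rw [tcProc_zero hc0]
    show (Real.sqrt κ)⁻¹ * imgMartK κ hA hne n 0 ω = 0
    rw [imgMartK_zero, mul_zero]
  set M : ℝ≥0 → (ℝ≥0 → ℝ) × (ℝ≥0 → ℝ) → ℝ := fun s z ↦ tcProc Y c ρ s z.1 +
    (Literature.Probability.Process.brownian s z.2 - Literature.Probability.Process.brownian (min s (σc z.1)) z.2) with hMdef
  have hBM : IsBrownianReal M (Q.prod preWienerMeasure) := isBrownianReal_concat htc' hcontY hYad' hσcm hcad' hY0 rfl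
  have hMc : ∀ z, Continuous (M · z) := continuous_concat rfl hcontY
  have hMm : ∀ t, Measurable (M t) := measurable_concat hMdef hYad' hcad'
  refine ⟨M, hBM, hMm, hMc, ?_⟩
  -- Step 3: agreement with the image driver in capacity time
  rintro ⟨ω, ω'⟩ T₀ hT₀ hT0 s hs
  simp only at hT₀ hs ⊢
  set W := drvK κ (brownianCPath ω) with hWdef
  have hWc : Continuous W := continuous_drvK κ _
  have hτT : τ ω = T₀ := hT₀
  have h0 : (0 : WithTop ℝ≥0) < τ ω := by rw [hτT]; exact_mod_cast hT0
  have hρω : ρ ω = T₀ := WithTop.coe_injective ((hρcoe ω).trans hτT)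
  have hleT : ((T₀ : ℝ≥0) : WithTop ℝ≥0) ≤ τ ω := by rw [hτT]
  have hβ : Disjoint (closedHull W T₀) A := (imgDrvP_eq_of_le (κ := κ) (hA := hA) (hne := hne) (n := n) hleT h0).1
  -- the capacity time `s` is `σ(t)` for `t = τ_clock(s) ∈ [0, T₀]`
  have hsI : (s : ℝ) ∈ Icc (0 : ℝ) (imageClock W A T₀) := ⟨s.coe_nonneg, hs⟩
  obtain ⟨htI, hσt⟩ := imageClockInv_spec hWc hA hne hβ hsI
  set t : ℝ := imageClockInv W A T₀ s with htdef
  set t' : ℝ≥0 := t.toNNReal with ht'def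
  have ht'coe : (t' : ℝ) = t := Real.coe_toNNReal _ htI.1
  have ht'le : t' ≤ T₀ := by
    have := Real.toNNReal_le_toNNReal htI.2; rwa [Real.toNNReal_coe] at this
  have ht'ρ : t' ≤ ρ ω := hρω ▸ ht'le
  have ht'τ : ((t' : ℝ≥0) : WithTop ℝ≥0) ≤ τ ω := by rw [← hρcoe]; exact WithTop.coe_le_coe.2 ht'ρ
  -- the clock and the process at `t'`
  have hct' : c t' ω = s := by
    rw [hcdef, imgClockK_eq_imageClock ht'τ h0, ← hWdef, ht'coe, hσt]
  have hMt' : imgMartK κ hA hne n t' ω = imageDriver W A t' := imgMartK_eq_imageDriver ht'τ h0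
  -- `M s = Ỹ_s = Y_{t'}`
  have hle : s ≤ σc ω := by
    rw [← NNReal.coe_le_coe, hσccoe, totalClock, ← hct']
    exact hmono ω ht'ρ
  have hMs : M s (ω, ω') = Y t' ω := by
    have hcat : M s (ω, ω') = tcProc Y c ρ s ω := @concat_eq_of_le _ (tcProc Y c ρ) σc M hMdef s (ω, ω') hle
    rw [hcat]
    have h1 := tcProc_clock (Y := Y) hcc hstrict hnn ht'ρ
    change tcProc Y c ρ (c t' ω).toNNReal ω = Y t' ω at h1
    rw [hct', Real.toNNReal_coe] at h1
    exact h1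
  rw [hMs]
  show Real.sqrt κ * ((Real.sqrt κ)⁻¹ * imgMartK κ hA hne n t' ω) = imageDriverC W A T₀ s
  rw [← mul_assoc, mul_inv_cancel₀ hsκ.ne', one_mul, hMt', imageDriverC, min_eq_left hs]

/-- **(T4) — the image Brownian motion of SLE_κ under the tilted probability.** For `0 < κ ≤ 8/3`, a
nonempty `A ∈ 𝒬*` with restriction data `(Φ, d)`, a compensated restriction martingale `Y` of [LSW]
Prop. 5.3 and a level `n`, IF `Mⁿ · Y` and `((Mⁿ)² − κ cⁿ) · Y` are `P`-martingales ((T2); `Mⁿ = imgMartK`,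
`cⁿ = imgClockK`), THEN with `Q̄_A = (Y_∞ / Φ_A′(0)^α) · P` there is on `(Ω × Ω, Q̄_A ⊗ P_W)` a real
Brownian motion `Bc` (continuous paths, measurable marginals) with `√κ · Bc s = imageDriverC W A T₀ s`
for `s ≤ imageClock W A T₀` whenever the localising time `T₀` is positive: "under the tilted measure,
`W̃ ∘ τ / √κ` is a standard Brownian motion" ([LSW] §5 with Prop. 5.3; the case `κ = 6`, `Y ≡ 1` is
the tree's `exists_sle_image_brownian`). [cite: LawlerSchrammWerner2003Restriction, Prop. 5.3 with §5 (5.1)–(5.3)] -/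
theorem exists_sle_image_brownian_tilted :
    ∀ (κ : ℝ≥0) (hκ0 : 0 < κ) (hκ : κ ≤ 8 / 3) (A : Set ℂ) (hA : IsStarHull A) (hne : A.Nonempty)
      (Φ : ConformalEquiv (upperHalfPlaneSet \ A) upperHalfPlaneSet), IsRestrictionMap A Φ →
      ∀ (d : ℝ), HasRestrictionDeriv A Φ d → ∀ (Y : ℝ≥0 → (ℝ≥0 → ℝ) → ℝ),
        IsRestrictionMartingaleK κ (sleBubbleExponent κ) (sleBubbleIntensityReal κ) A (LpK κ A) Y → ∀ (n : ℕ),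
        Martingale (fun t ω => imgMartK κ hA hne n t ω * Y t ω) brownianFiltration preWienerMeasure →
        Martingale (fun t ω => (imgMartK κ hA hne n t ω ^ 2 - κ * imgClockK κ hA hne n t ω) * Y t ω)
          brownianFiltration preWienerMeasure →
        ∃ Bc : ℝ≥0 → (ℝ≥0 → ℝ) × (ℝ≥0 → ℝ) → ℝ,
          IsBrownianReal Bc ((preWienerMeasure.withDensity fun ω =>
              ENNReal.ofReal ((d ^ sleBubbleExponent κ)⁻¹ * Yinf Y ω)).prod preWienerMeasure) ∧
          (∀ s, Measurable (Bc s)) ∧ (∀ z, Continuous (Bc · z)) ∧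
          ∀ (z : (ℝ≥0 → ℝ) × (ℝ≥0 → ℝ)) (T₀ : ℝ≥0), imgLocTimeK κ hA hne n z.1 = T₀ → 0 < T₀ →
            ∀ s : ℝ≥0, (s : ℝ) ≤ Loewner.imageClock (drvK κ (brownianCPath z.1)) A T₀ →
              Real.sqrt κ * Bc s z = Loewner.imageDriverC (drvK κ (brownianCPath z.1)) A T₀ s := by
  intro κ hκ0 hκ A hA hne Φ hΦ d hd Y hY n hMY hM2Y
  obtain ⟨hprob, N, hclock⟩ := hasMartingaleClock_imgMartK_tilted κ hκ0 hκ A hA hne Φ hΦ d hd Y hY n hMY hM2Y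
  haveI := hprob
  exact exists_sle_image_brownian_of_clock hκ0 hA hne n hclock

end Summit.CriticalPhenomena.SAWScalingLimit.Theorems.SubseqIdentification.BoundaryAreaLaw

end
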